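import Summits.ABC.IUTFork.Joshi.HodgeTheatersJoshiOverDeformation
import HarnessLib

/-!
# [J-III] Thm. 10.11.5.1 vs. Prop. 10.3.3 (2) over the [J-2½] carrier — the isomorphism `Frob(arith(L)_{y₁})^ℝ ≅ Frob(arith(L)_{y₂})^ℝ`
# made EXPLICIT, and what it does to degrees: RAW local degrees `log|−|` are rescaled by `α_v(y₁)/α_v(y₂)`, NORMALISED local degrees
# `α_v(y_v)·log|−|_{K_{y_v}}` ([J-2½] (5.3.3)/(5.3.4)) are PRESERVED — proof-side sequel of `Joshi/HodgeTheatersJoshiOverDeformation.lean`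

abc-iut cell, branch E (rung LADDER-ABC:A2.E), seat abc-iut-E-t32 (gen 2); sequel of p437595 (`HodgeTheatersJoshiOverDeformation.lean`) and p433294
(`HodgeTheatersJoshiGlobalIso.lean`). Sources and framing as there: [J-III] = arXiv:2401.13508 v4 (`Joshi2024ATS3`), [J-2½] = arXiv:2305.10398
(`Joshi2023ATS2half`); UNREFEREED, typed AS CANDIDATES; typed ≠ proved ≠ endorsed; no side taken on [IUTchIII] Cor. 3.12 or on any author; no
Cor. 3.12 vocabulary (E-PLAN R14). Inputs BY NAME: E-t37's `DeformationDatum.α`, `α_pos`, `alpha_mul_log_absK_iota` ((5.3.3) in logs), this seat's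
`Frob.unitRpow*`, `realDivMonoid(Restrict)`, `ArithmeticoidAbsDatum.{frobArithR, absAt, ofDeformation, absAt_ofDeformation_rpow}`.

WHAT IS HERE.
1. `ArithmeticoidAbsDatum.frobArithRIso A c hc hceq` — the EXPLICIT form of p433294's isomorphism `Frob(arith(L)_{y₁})^ℝ ≅ Frob(arith(L)_{y₂})^ℝ` for
   a value datum `A` and a placewise dilatation `|−|_{y₂,v} = |−|_{y₁,v}^{c_v}` (`c_v > 0`): on `Φ^gp = ∏_v ℝ^×` the placewise signed power
   `r ↦ r·|r|^{c_v−1}` (`frobArithRIso_γ_apply`), on `Φ^ℝ = ∏_v (0,1]` its restriction, on `B = L^*` the identity (`frobArithRIso_β`). (p433294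
   proves `IsIso` by the same construction behind an existential; a named `def` is needed to speak about ITS action on degrees.)
2. Over a [J-2½] deformation datum `D` (merge map `ofDeformation D h` of p437595) the exponents are `c_v = α_v(y₁)/α_v(y₂)`
   (`frobArithRIsoOfDeformation`), and in kernel:
   * RAW local degrees are RESCALED: `log|(γ r)_v| = (α_v(y₁)/α_v(y₂))·log|r_v|` (`log_abs_γ_ofDeformation`) — the content of Prop. 10.3.3 (2)
     («no isomorphism compatible with the identity of `ℝ` in the arithmetic degrees» unless the exponent is `1`, p.132 l.4–23);
   * NORMALISED local degrees are PRESERVED: `α_v(y₂)·log|(γ r)_v| = α_v(y₁)·log|r_v|` for every `r ∈ ∏_v ℝ^×` and every place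
     (`normLog_γ_ofDeformation`), hence also their sums over places (`finsum_normLog_γ_ofDeformation` — the weights of [J-2½] Thm. 5.10.1 (4)'s
     product-formula hyperplane `H_y = {Σ_v α_v z_v = 0}`);
   * on PRINCIPAL divisors the normalised local degree does not depend on the arithmeticoid at all: `α_v(y_v)·log|ι_{y_v}(x)|_{K_{y_v}} = log|x|_v`
     (E-t37's `alpha_mul_log_absK_iota`, read on the constructed Frobenioids: `alpha_mul_log_frobArithR_div`, `alpha_mul_log_frobArithR_div_eq`).
LOCATED (Joshi's own carriers; no adjudication): the «valuation-rescaling» between two arithmeticoids of `L` is a change of exponent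
`α_v(y₁)/α_v(y₂)` in un-normalised coordinates; the Thm. 10.11.5.1 isomorphism is degree-INcompatible for the raw degrees `log|−|_{K_y}` exactly
when `α_v(y₁) ≠ α_v(y₂)` (p437595 `exists_degCompatible_ofDeformation_iff`) and degree-COMPATIBLE for the normalised degrees of (5.3.3)/(5.3.4),
in which every arithmeticoid reads the standard `log|x|_v` on `L`. Which degree a downstream construction consumes (raw vs normalised) is therefore
where any effect of «distinct arithmetic holomorphic structures» on value/degree data of elements of `L` must enter — recorded for the cell's X-07′ /
E-LOCATION L1 discussion, not adjudicated here. [claim: Joshi2024ATS3, status: disputed]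
-/

noncomputable section

namespace Summit.ABC.IUTFork.Joshi.ATS3

open ATS2h

namespace Frob

/-- `log|r·|r|^{c−1}| = c·log|r|`: the signed power multiplies logarithms of absolute values by its exponent. [folklore] -/
theorem log_abs_unitRpow (c : ℝ) (r : ℝˣ) : Real.log |(unitRpow c r : ℝ)| = c * Real.log |(r : ℝ)| := by
  have hr : 0 < |(r : ℝ)| := abs_pos.2 r.ne_zero
  have h1 : |(unitRpow c r : ℝ)| = |(r : ℝ)| ^ c := by
    rw [val_unitRpow, abs_mul, abs_of_pos (Real.rpow_pos_of_pos hr _)]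
    conv_rhs => rw [show c = 1 + (c - 1) by ring, Real.rpow_add hr, Real.rpow_one]
  rw [h1, Real.log_rpow hr]

/-- Normalised form: for exponent `c = α₁/α₂`, `α₂·log|r^{c}| = α₁·log|r|` — the signed power carries `α₁`-normalised logarithms to
`α₂`-normalised ones. [folklore] -/
theorem normLog_unitRpow_div {α₁ α₂ : ℝ} (hα₂ : α₂ ≠ 0) (r : ℝˣ) :
    α₂ * Real.log |(unitRpow (α₁ / α₂) r : ℝ)| = α₁ * Real.log |(r : ℝ)| := by
  rw [log_abs_unitRpow, ← mul_assoc, mul_div_cancel₀ α₁ hα₂]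

end Frob

namespace ArithmeticoidAbsDatum

section Explicit

variable {L : Type} [Field L] {Pl : Type} {Pt : Pl → Type} {K : ∀ v, Pt v → Type} [∀ v y, Field (K v y)]
  (A : ArithmeticoidAbsDatum L Pl Pt K) {y₁ y₂ : ∀ v, Pt v} (c : Pl → ℝ) (hc : ∀ v, 0 < c v)
  (hceq : ∀ v (x : L), A.absAt y₂ v x = A.absAt y₁ v x ^ c v)

/-- The placewise signed-power automorphism of `Φ^gp = ∏_v ℝ^×` at exponents `c_v ≠ 0`. [folklore] -/
def piUnitRpowEquiv : (Pl → ℝˣ) ≃* (Pl → ℝˣ) := MulEquiv.piCongrRight fun v => Frob.unitRpowEquiv (c v) (hc v).ne'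

/-- It acts placewise by `unitRpow (c v)`. [folklore] -/
@[simp] theorem piUnitRpowEquiv_apply (r : Pl → ℝˣ) (v : Pl) : piUnitRpowEquiv c hc r v = Frob.unitRpow (c v) (r v) := rfl

/-- It preserves the realified divisor monoid `∏_v (0,1]`. [folklore] -/
theorem piUnitRpowEquiv_mem {r : Pl → ℝˣ} (hr : r ∈ realDivMonoid Pl) : piUnitRpowEquiv c hc r ∈ realDivMonoid Pl := fun v => by
  rw [piUnitRpowEquiv_apply]
  exact Frob.unitRpow_mem_unitInterval (hc v) (hr v).1 (hr v).2

/-- So does its inverse (exponents `c_v⁻¹`). [folklore] -/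
theorem piUnitRpowEquiv_symm_mem {r : Pl → ℝˣ} (hr : r ∈ realDivMonoid Pl) : (piUnitRpowEquiv c hc).symm r ∈ realDivMonoid Pl := fun v => by
  simp only [piUnitRpowEquiv, MulEquiv.piCongrRight_symm, MulEquiv.piCongrRight_apply, Frob.unitRpowEquiv_symm_apply]
  exact Frob.unitRpow_mem_unitInterval (inv_pos.2 (hc v)) (hr v).1 (hr v).2

/-- **The Thm. 10.11.5.1 isomorphism `Frob(arith(L)_{y₁})^ℝ ≅ Frob(arith(L)_{y₂})^ℝ` made EXPLICIT** for a value datum and a placewise dilatation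
`|−|_{y₂,v} = |−|_{y₁,v}^{c_v}`, `c_v > 0` (the construction inside p433294's `frobArithR_isIso_of_isEquiv`, now a named isomorphism): `γ` = placewise
signed powers, `φ` = their restriction to `∏_v (0,1]`, `β` = identity of `L^*`. [folklore] -/
def frobArithRIso : (A.frobArithR y₁).Iso (A.frobArithR y₂) where
  φ := realDivMonoidRestrict (piUnitRpowEquiv c hc) (fun _ hr => piUnitRpowEquiv_mem c hc hr)
    (fun _ hr => piUnitRpowEquiv_symm_mem c hc hr)
  γ := piUnitRpowEquiv c hc
  β := MulEquiv.refl _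
  toGp_comm _ := rfl
  div_comm x := by
    funext v
    apply Units.ext
    have hx : 0 < ((Frob.absUnits (A.absAt y₁ v) x : ℝˣ) : ℝ) := by
      rw [Frob.val_absUnits]; exact (A.absAt y₁ v).pos x.ne_zero
    change (Frob.unitRpow (c v) (Frob.absUnits (A.absAt y₁ v) x) : ℝ) = (Frob.absUnits (A.absAt y₂ v) x : ℝ)
    rw [Frob.val_unitRpow_of_pos _ hx, Frob.val_absUnits, Frob.val_absUnits, hceq v]

/-- Its action on `Φ^gp = ∏_v ℝ^×`: placewise `r_v ↦ r_v·|r_v|^{c_v−1}`. [folklore] -/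
@[simp] theorem frobArithRIso_γ_apply (r : Pl → ℝˣ) (v : Pl) : (A.frobArithRIso c hc hceq).γ r v = Frob.unitRpow (c v) (r v) := rfl

/-- Its action on `B = L^*`: the identity. [folklore] -/
@[simp] theorem frobArithRIso_β_apply (x : Lˣ) : (A.frobArithRIso c hc hceq).β x = x := rfl

/-- RAW local degrees are rescaled by the exponent: `log|(γ r)_v| = c_v·log|r_v|`. [folklore] -/
theorem log_abs_frobArithRIso_γ (r : Pl → ℝˣ) (v : Pl) :
    Real.log |((A.frobArithRIso c hc hceq).γ r v : ℝ)| = c v * Real.log |(r v : ℝ)| := by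
  rw [frobArithRIso_γ_apply, Frob.log_abs_unitRpow]

end Explicit

section Deformation

variable {L : Type} [Field L] {V : Type} {Lv : V → Type} [∀ v, Field (Lv v)] {Y : V → Type}
  [∀ v, TopologicalSpace (Y v)] {K : (v : V) → Y v → Type} [∀ v y, Field (K v y)] [∀ v y, TopologicalSpace (K v y)]
  {Gal : V → Type} [∀ v, Group (Gal v)] {Aut : V → Type} [∀ v, Group (Aut v)]
  (D : DeformationDatum L V Lv Y K Gal Aut) (h : TriangleValued D)

/-- **The Thm. 10.11.5.1 isomorphism between the realified arithmetic Frobenioids of two arithmeticoids of a [J-2½] deformation datum**, with the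
exponents READ OFF the normalisation coordinates: `c_v = α_v(y₁)/α_v(y₂)` (p437595 `absAt_ofDeformation_rpow`). [folklore] -/
def frobArithRIsoOfDeformation (y₁ y₂ : D.Arith) :
    ((ofDeformation D h).frobArithR y₁).Iso ((ofDeformation D h).frobArithR y₂) :=
  (ofDeformation D h).frobArithRIso (fun v => D.α v (y₁ v) / D.α v (y₂ v))
    (fun v => div_pos (D.α_pos v (y₁ v)) (D.α_pos v (y₂ v))) (absAt_ofDeformation_rpow D h y₁ y₂)

/-- **Prop. 10.3.3 (2) content — RAW degrees rescaled**: on `Φ^gp` the isomorphism multiplies `log|−|` at `v` by `α_v(y₁)/α_v(y₂)`. [folklore] -/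
theorem log_abs_γ_ofDeformation (y₁ y₂ : D.Arith) (r : V → ℝˣ) (v : V) :
    Real.log |((frobArithRIsoOfDeformation D h y₁ y₂).γ r v : ℝ)| = D.α v (y₁ v) / D.α v (y₂ v) * Real.log |(r v : ℝ)| :=
  log_abs_frobArithRIso_γ _ _ _ _ r v

/-- **NORMALISED degrees preserved**: `α_v(y₂)·log|(γ r)_v| = α_v(y₁)·log|r_v|` — the Thm. 10.11.5.1 isomorphism carries the `y₁`-normalised local
degrees of [J-2½] (5.3.3)/(5.3.4) to the `y₂`-normalised ones, at every place and for every element of `Φ^gp`. [folklore] -/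
theorem normLog_γ_ofDeformation (y₁ y₂ : D.Arith) (r : V → ℝˣ) (v : V) :
    D.α v (y₂ v) * Real.log |((frobArithRIsoOfDeformation D h y₁ y₂).γ r v : ℝ)| = D.α v (y₁ v) * Real.log |(r v : ℝ)| := by
  rw [log_abs_γ_ofDeformation, ← mul_assoc, mul_div_cancel₀ _ (D.α_pos v (y₂ v)).ne']

/-- … hence the WEIGHTED sums over places agree as well (the weights of [J-2½] Thm. 5.10.1 (4)'s hyperplane `H_y = {Σ_v α_v(y_v)·z_v = 0}`; `Σᶠ`
with its finite-support convention on both sides). [folklore] -/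
theorem finsum_normLog_γ_ofDeformation (y₁ y₂ : D.Arith) (r : V → ℝˣ) :
    ∑ᶠ v, D.α v (y₂ v) * Real.log |((frobArithRIsoOfDeformation D h y₁ y₂).γ r v : ℝ)| = ∑ᶠ v, D.α v (y₁ v) * Real.log |(r v : ℝ)| :=
  finsum_congr fun v => normLog_γ_ofDeformation D h y₁ y₂ r v

/-- The `v`-component of the principal divisor of `x ∈ L^*` in the realified `Frob(arith(L)_y)^ℝ` over the merged datum is `|ι_{y_v}(x)|`.
[folklore] -/
theorem val_frobArithR_div_ofDeformation (y : D.Arith) (x : Lˣ) (v : V) :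
    ((((ofDeformation D h).frobArithR y).div x v : ℝˣ) : ℝ) = D.absK v (y v) (D.iota y v x) := rfl

/-- **On principal divisors the normalised local degree does not depend on the arithmeticoid**: `α_v(y_v)·log|div_y(x)_v| = log|x|_v` for EVERY
`y` — E-t37's `alpha_mul_log_absK_iota` ((5.3.3) in logarithms) read on the constructed Frobenioid. [folklore] -/
theorem alpha_mul_log_frobArithR_div (y : D.Arith) (x : Lˣ) (v : V) :
    D.α v (y v) * Real.log ((((ofDeformation D h).frobArithR y).div x v : ℝˣ) : ℝ) = Real.log (D.absLv v (D.toLv v x)) := by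
  rw [val_frobArithR_div_ofDeformation, D.alpha_mul_log_absK_iota]

/-- … so two arithmeticoids give the SAME normalised local degrees to every principal divisor. [folklore] -/
theorem alpha_mul_log_frobArithR_div_eq (y₁ y₂ : D.Arith) (x : Lˣ) (v : V) :
    D.α v (y₁ v) * Real.log ((((ofDeformation D h).frobArithR y₁).div x v : ℝˣ) : ℝ) =
      D.α v (y₂ v) * Real.log ((((ofDeformation D h).frobArithR y₂).div x v : ℝˣ) : ℝ) := by
  rw [alpha_mul_log_frobArithR_div, alpha_mul_log_frobArithR_div]

end Deformation

end ArithmeticoidAbsDatum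

end Summit.ABC.IUTFork.Joshi.ATS3

end
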